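import Summits.HodgeConjecture.HodgeConjecture.Theorems.K2E1bDSCellArithmetic   -- ★ p856269 (K2E4-p10 (g2)): §1–§4 of ED. 1 VERBATIM (the 23 identities), over ★ p856254 `K2E1bDSCellParamsDefs` (§0: the 6 parameters)
import HarnessLib

/-!
# K2 ∕ E1b tier 1 · unit U8c «LEVEL-B DICTIONARY, ARITHMETIC HALF» — the Kovačević parameters `(c_K, t)` of the three principal series through
# the discrete-series packet `Π(φ(a,b,c))` of `U(2,1)`, their root lines, vertices and Casimir, PROVED (no socket)

Track B ∕ engine E1b, line `K2_E1b_GKCohomologyU21`, socket item stmt-HodgeConjecture-24833 (h413).  This module is the machine-checked half of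
§2b «LEVEL-B DICTIONARY» of `Lines/K2_E1b_GKCohomologyU21_U8_ArchPacketSigns.md` (ED. 2): it fixes, for a parameter `a > b > c`, the Kovačević
data of the `(+)`-series (`JH = {J_φ⁺, D_φ⁺, D_φ}` [Rogawski1990 §12.3 p. 177]), the `(−)`-series (`{J_φ⁻, D_φ⁻, D_φ}`) and the 4-cell series
(`{F_φ, J_φ^±, D_φ}`), and PROVES the polynomial identities the U8-3 hand (`Theorems/K2E1bDSCellData.lean`, row U8-3) needs: the factorisations of
★ `acoef`∕`bcoef` along each series (hence the EXACT root lines cutting out the cells `D_φ⁺ = [0,∞)×[0,a−b−1]`, `J_φ⁺`, `D_φ = [0,∞)×[a−c,∞)`, …), the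
Casimir identity `4c_K + 2t²∕3 = casimirOf − centralOf²∕3` (★ `casimir_principalSeries` vs the tier-1 twist), the integrality `2t + 2e ∈ 6ℤ`, and
the vertex (lowest `K`-type) coordinates.  Everything is `ring`∕`omega`-level; NOTHING here is a socket and nothing closes h413 — it removes the
guesswork from row U8-3 (the representation-theoretic content — that these cells ARE `D_φ, D_φ^±` with the Blattner vertices — stays in U8-3∕U8-4).

## THE DICTIONARY (see the TABLE §2b for the derivation: Blattner `Λ = λ + ρ_n − ρ_c`, ★ `kTypeMatTw` exponents `a′ = (m−3n+3+2e)∕6`, `b′ = (e−m)∕3`)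

Kovačević coordinates of ★ `V(c,2t) = SU21Datum.principalSeries c t`: `K`-types `(n,m) = (1+p+q, 2t+3p−3q)`, `p,q ≥ 0`; ★ `acoef c t p = 2c − (p+1)t − p(p+2)`,
★ `bcoef c t q = 2c + (q+1)t − q(q+2)` [Kovacevic2021 §3 Thm 3 (b85)(b90)].
* `(+)`-series: `t⁺ = 2a − b − c`, `2c_K⁺ = (a−b−1)(a−b+1) − (a−b)(2a−b−c)`; `bcoef = −(q − (a−b−1))(q − (a−c−1))`, `acoef = −(p + a − b + 1)(p + a − c + 1)`.
* `(−)`-series: `t⁻ = −a − b + 2c`, `2c_K⁻ = (b−c−1)(b−c+1) + (b−c)(−a−b+2c)`; `acoef = −(p − (b−c−1))(p − (a−c−1))`, `bcoef = −(q + b − c + 1)(q + a − c + 1)`.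
* 4-cell series: `t″ = −a + 2b − c`, `2c″ = (a−b)(−a+2b−c) + (a−b−1)(a−b+1)`; `acoef = −(p − (a−b−1))(p + b − c + 1)`, `bcoef = −(q − (b−c−1))(q + a − b + 1)`.
Vertices (lowest `K`-types): `D_φ (a−c+1, a+c−2b)`, `D_φ⁺ (a−b, a+b−2c+3)`, `D_φ⁻ (b−c, b+c−2a−3)`; at `(1,0,−1)`: `(3,0), (1,6), (1,−6)` = ★ `midDS`, `holDS`, `antiholDS`.
(Rogawski1990, §12.3 pp. 176–177) (Kovacevic2021, §3 Thm 3; §6) (BorelWallach2000, VI §4 4.10) — arithmetic of the engine line (hence untagged).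

ED. 2 (K2E1b-plan (g2), 2026-09-04): **EVERYTHING MOVED TO ★ LEAVES** (ORDER #1 §3 «DEFS BEFORE SIGS», K2-lead R3 (d)).  §0 (the 6 parameter definitions
`tPlus cKPlus tMinus cKMinus tBox cKBox`) landed VERBATIM as ★ p856254 `Theorems/K2E1bDSCellParamsDefs.lean` (commit f5597e5065d1) and §1–§4 (the 23 proved
identities `bcoef_plus … rootLines_in_cone`) VERBATIM as ★ p856269 `Theorems/K2E1bDSCellArithmetic.lean` (K2E4-p10 (g2), E1b STANDING QUEUE Q4 (a)(b), 2026-09-04T00:50:43Z),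
both in THIS namespace, so every fully-qualified name of ED. 1 (commit 76719c64e04a) is unchanged and now ★.  This module keeps 0 local declarations: it is the
re-export shim of the engine line (consumers may import either this module or the leaf) plus §5, a handful of `example`s re-checking BY NAME that the ★ statements are
the bytes ED. 1 stated.  It no longer imports the U8 Lines module.
-/

set_option autoImplicit false
set_option linter.dupNamespace false

noncomputable section

namespace Summit.HodgeConjecture.HodgeConjecture.Cruxes.H413.K2E1bGKCohomologyU21.U8.LevelB

open Literature.RepresentationTheory.Kovacevic2021.SU21Datum.PrincipalSeries (acoef bcoef)

/-! ## §0–§4 (ED. 2): see ★ `Theorems/K2E1bDSCellParamsDefs.lean` and ★ `Theorems/K2E1bDSCellArithmetic.lean` (same namespace, same names, same bytes). -/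

/-! ## §5 Re-check of the ★ statements BY NAME (statement bytes of ED. 1) -/

example (a b c : ℤ) : tPlus a b c = 2 * a - b - c := rfl
example (a b c : ℤ) : tMinus a b c = -a - b + 2 * c := rfl
example (a b c q : ℤ) : bcoef (cKPlus a b c) (tPlus a b c) q = 0 ↔ q = a - b - 1 ∨ q = a - c - 1 := bcoef_plus_eq_zero_iff a b c q
example {a b c p : ℤ} (hab : b < a) (hac : c < a) (hp : 0 ≤ p) : acoef (cKPlus a b c) (tPlus a b c) p ≠ 0 := acoef_plus_ne_zero hab hac hp
example (a b c p : ℤ) : acoef (cKMinus a b c) (tMinus a b c) p = 0 ↔ p = b - c - 1 ∨ p = a - c - 1 := acoef_minus_eq_zero_iff a b c p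
example {a b c q : ℤ} (hbc : c < b) (hac : c < a) (hq : 0 ≤ q) : bcoef (cKMinus a b c) (tMinus a b c) q ≠ 0 := bcoef_minus_ne_zero hbc hac hq
example (a b c : ℤ) : 4 * cKPlus a b c + 2 * ((tPlus a b c : ℤ) : ℂ) ^ 2 / 3 = (casimirOf a b c : ℂ) - ((centralOf a b c : ℤ) : ℂ) ^ 2 / 3 :=
  casimir_plus a b c
example (a b c : ℤ) : 4 * cKMinus a b c + 2 * ((tMinus a b c : ℤ) : ℂ) ^ 2 / 3 = (casimirOf a b c : ℂ) - ((centralOf a b c : ℤ) : ℂ) ^ 2 / 3 :=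
  casimir_minus a b c
example (a b c p q : ℤ) : (2 * tPlus a b c + 3 * p - 3 * q) - 3 * (1 + p + q) + 3 + 2 * centralOf a b c = 6 * (a - q) := twist_integral_plus a b c p q
example (a b c : ℤ) : (1 + 0 + (a - b - 1), 2 * tPlus a b c + 3 * 0 - 3 * (a - b - 1)) = (a - b, a + b - 2 * c + 3) := vertex_Dplus a b c
example (a b c : ℤ) : (1 + (b - c - 1) + 0, 2 * tMinus a b c + 3 * (b - c - 1) - 3 * 0) = (b - c, b + c - 2 * a - 3) := vertex_Dminus a b c
example {a b c : ℤ} (h : IsRegularParam a b c) : 0 ≤ a - b - 1 ∧ a - b - 1 < a - c - 1 ∧ 0 ≤ b - c - 1 ∧ b - c - 1 < a - c - 1 := rootLines_in_cone h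

end Summit.HodgeConjecture.HodgeConjecture.Cruxes.H413.K2E1bGKCohomologyU21.U8.LevelB

end
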